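import Literature.MathematicalPhysics.QuantumFieldTheory.Balaban1983to89.B9Eq3126H1kPiSupRowClosed
import Literature.MathematicalPhysics.QuantumFieldTheory.Balaban1983to89.B9Eq342TowerBigBlocks

/-!
# T. Bałaban, *Propagators for lattice gauge theories in a background field*, Commun. Math. Phys. **99** (1985) 389–434 [Balaban1985BackgroundPropagators]
# p. 422, between (3.136) and (3.137): *«From the regularity condition (3.36) and the inequality (3.133) we have the estimate |(H\*J)(b)| ≦ O(1)Mα₀(Lʲη)⁻³
# for b ∈ Λ_j»* — **THE `(H̃*J)`-BUDGET OF (3.136) AT THE TOWER**: the sup row of the Hilbert ADJOINT `H̃_k†` of NE9's `H̃_k = G̃_kQ_k†(Q_kG̃_kQ_k†)⁻¹`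
# (`B11Eq103H1Complex.H1LatticeK` at print's `G̃_k`, (3.126) ∕ (3.130)) from ne9-leaf-05's (K81) local sup letter of `H̃_k`
# (`B9Eq3126H1kPiSupRowClosed.exists_local_letter_H1LatticeKPi`, the (3.133) row): for every fine bond field `f` with `‖f‖_∞ ≤ F`,
# `‖(H̃_k†f)(c)‖ ≤ B′·F` at every coarse bond `c`, `B′ = d·B·K_δ` uniform in the height and the torus («Y14», row (D4) OWNER lineage, gen 114)

CITATION HEADER (lean-in-tree rule 2026-08-18).  Audit cell `pub-balaban`, BINDER row (D4) (`RemainderConst` leaves for Bałaban's split), OWNER lineage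
`b2b-balaban-beta-an4`, gen 114.  [Balaban1985BackgroundPropagators] (B9 = [5]; held `paper:balaban1985-cmp99-background-propagators`, journal page = PDF
page + 388): p. 422 (the sentence quoted above, re-read first-hand this generation on the held text), (3.11) p. 392 (the weighted `L²` scalar products),
(3.126) p. 420, (3.133) p. 422, (3.134)–(3.137) pp. 422–423, (3.36) p. 396; [Balaban1984PropagatorsII] (B6 = [3]) Lemma 2.1 (2.61) p. 234 (lattice sums of
`e^{−δd}`); [Balaban1985Averaging] (B7 = [4]) (2)–(4) pp. 17–18 (the blocks).  Composed BY NAME: ne9-leaf-05 g88's (K81) `exists_local_letter_H1LatticeKPi`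
(its binder block VERBATIM), `B9Eq342TowerBigBlocks.card_sites_bigBlock_le` (`#Π⁻¹(y) ≤ (L^k)^d`), `B4Sect5Torus.torusSum_le` ∕ `tdist_symm`,
`B9Eq311L2Pairing.WL2.inner_def`, Mathlib's `LinearMap.adjoint_inner_right`.  Nothing of print is asserted here.

WHY THIS FILE («Y14»).  Print's `Δ⁽²⁾` of (3.134) is `⟨A, Δ⁽²⁾A⟩ = 2⟨HC⁽²⁾(A), J⟩`, written in (3.136) as `Δ⁽²⁾A = Σ_j Σ_{b∈Λ_j} (Lʲη)^{d+1} tr (δ∕δA)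
C_j⁽²⁾(A,b)(H\*J)(b)`; its bound (3.137) — the LAST displayed analytic letter of row (D4)'s NODE D at the origin, re-typed in print's words by «Y13a∕b∕c»
(this gen) — rests on THREE ingredients: (i) [4] (149) for the second-order term `C⁽²⁾` (lit-balaban's `B9Ineq3137From149` ∕ `B9Eq3134MatrixConcrete`, flat
carrier), (ii) the `(H\*J)`-BUDGET «|(H\*J)(b)| ≦ O(1)Mα₀(Lʲη)⁻³» from (3.36) + (3.133), (iii) the tower instantiation.  THIS FILE supplies (ii) ON NE9's
TOWER, in the cell's model currency, from the (3.133) row that landed today ((K81), 2026-08-25T20:32Z):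
* §1 **`weight_mul_norm_adjoint_apply_le_of_kernel`** ∕ **`norm_adjoint_apply_le_of_kernel`** (generic, weighted `ℓ²` spaces of `B9Eq311L2Pairing`): a linear
  `T : ℓ²(X; w) → ℓ²(Y; w′)` with `‖(T(δ_x·u))(y)‖ ≤ k(y,x)‖u‖` (`k ≥ 0`) has `w(x)‖(T†f)(x)‖ ≤ (Σ_y w′(y)k(y,x))·sup‖f‖`; constant weights: `‖(T†f)(x)‖ ≤
  (c₀∕c₁)(Σ_y k(y,x))·sup‖f‖` — `H*`'s row from `H`'s columns through the Hilbert adjoint of (3.11);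
* §2 **`sum_exp_tdist_bigBlock_le`** — `Σ_{fine bonds b} e^{−δ d(Π(b₋), v)} ≤ d·(L^{n+1})^d·K_δ` (`card_sites_bigBlock_le` + (2.61) `torusSum_le`);
* §3 **`exists_HJ_budget_tower`** — `∃ (α₁, j₁, B′)` FIRST; under (K81)'s binder block VERBATIM (the display `αU`, level profile `εU`, windows, transporters,
  `hpos′`, `hpos`, `hc₀η : c₀ = η^d`, the current window `hJ : ‖J‖ ≤ j₀ ≤ j₁`, `hposπ`, `hQ`), for every fine bond field `f : BondL2K … c₀ W` with
  `‖f(b)‖ ≤ F` and every coarse bond `c`: **`‖(H̃_k†f)(c)‖ ≤ B′·F`**, `H̃_k† = LinearMap.adjoint (H1LatticeK hposπ hQ)`, `B′ = d·B·K_δ` with `(B, δ)` (K81)'s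
  constants — the weights' ratio `c₀(L^{n+1})^d∕c₁ = 1` by the tower's normalisation `hw`.  At `f := J` (through `φ⁻¹`, `F = M_φ′·j₀`, `j₀ = O(α)` under
  (3.36)) this IS print's «|(H\*J)(b)| ≦ O(1)Mα₀» at the top level `Lᵏη = 1`.

HONEST SCOPE.  [folklore] Hilbert-space bookkeeping (the adjoint's row from the operator's columns; a fibre count; (2.61)) + ONE application of (K81); NO
estimate of [5] or [4] is proved here beyond that; (3.137) is NOT proved; `C⁽²⁾` at the tower and Bałaban's `Δ⁽²⁾(U)` are NOT constructed (ingredients (i),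
(iii) open: NODE-O class); (K81)'s hypotheses (`hpos′`, `hpos`, `hposπ`, `hQ`, the windows, `hc₀η`, `hJ`) stay HYPOTHESES, displayed; constants crude.
Row (D4) class UNCHANGED (instance 0∕1; critical-path width 0 = NODE O; D4 DISCHARGE NO DATE); NOT B12 Thm 2, NOT BetaPertH, NOT continuum, NOT Clay.
HONEST DEPENDENCY (cell line): continuum YM on T⁴ ⇐ BetaPertH ∧ nine spine estimates (0/9 proved); BetaPertH ⇐ (D1) ∧ (D4) ∧ CAP+tail; G-an2-4 gates
asym, D1 and NE2/3/4.  NEW file; nothing modified; 0 `def`; standard axioms; no `sorry`.  Net new unproved facts: 0.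
-/

noncomputable section

set_option autoImplicit false

open scoped BigOperators InnerProductSpace ComplexConjugate

namespace Literature.MathematicalPhysics.QuantumFieldTheory.Balaban1983to89.Beta.RemainderHJBudgetTower

open B9Eq311L2Pairing (WL2)
open B4Sect5Torus (TSite tdist tdist_nonneg tdist_symm torusSum_le)
open B4Sect5Proof (latticeConst latticeConst_nonneg)
open B9SectCLatticeCarrier (Bond bpos btgt unshift)
open B9Eq319QprimeTorus (fineP blockCoord)
open B7Prop1Explicit (U1 Wcx boxVec)
open B11Eq103H1Complex (SiteL2K BondL2K H1LatticeK)
open B9Eq310DeltaPrime (plaqHolU)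
open B9Eq310HessianOperator (adTransportW)
open B9Eq315QTorus (perCfg cornerSite)
open B9Eq315QTower (towerP UlevOf)
open B9Eq316TowerFlatIsOneStep (towerP_eq_fineP_pow siteCast)
open B9Eq326OperatorTower (QkW laplaceAk)
open B9Eq324DeltaPrimeATower (laplacePrimeAk)
open B9Eq3119DeltaPiTower (laplaceAkPi)
open B9Eq342TowerBigBlocks (card_sites_bigBlock_le)
open B9Eq3126H1kPiSupRowClosed (exists_local_letter_H1LatticeKPi)

/-! ## §1  The adjoint row from a kernel bound (weighted `ℓ²` spaces) -/

section Adjoint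

variable {X Y : Type*} [Fintype X] [Fintype Y] [DecidableEq X] {𝕜 : Type*} [RCLike 𝕜]
  {w : X → ℝ} {w' : Y → ℝ} [Fact (∀ x, 0 < w x)] [Fact (∀ y, 0 < w' y)]
  {V : Type*} [NormedAddCommGroup V] [InnerProductSpace 𝕜 V] [FiniteDimensional 𝕜 V]

/-- **THE ADJOINT ROW FROM A KERNEL BOUND.**  Weighted `ℓ²` spaces `ℓ²(X; w)`, `ℓ²(Y; w′)` (print's (3.11): weight `(Lʲη)^d` on the coarse bonds,
`η^d` on the fine bonds) and a linear `T : ℓ²(X; w) → ℓ²(Y; w′)` whose value on a one-point source is bounded entrywise by a kernel `k ≥ 0`,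
`‖(T(δ_x·u))(y)‖ ≤ k(y,x)·‖u‖`: then the Hilbert ADJOINT `T†` has the sup row `w(x)·‖(T†f)(x)‖ ≤ (Σ_y w′(y)k(y,x))·F` whenever `‖f(y)‖ ≤ F` everywhere
(`⟨δ_x·u, T†f⟩ = w(x)⟨u, (T†f)(x)⟩ = ⟨T(δ_x·u), f⟩ = Σ_y w′(y)⟨(T(δ_x·u))(y), f(y)⟩` at `u := (T†f)(x)`).  The shape of print's sentence before (3.137):
*«From the regularity condition (3.36) and the inequality (3.133) we have the estimate |(H\*J)(b)| ≤ O(1)Mα₀(Lʲη)⁻³»* — `H*`'s row from `H`'s columns.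
[cite: Balaban1985BackgroundPropagators, (3.11) p.392, (3.136)–(3.137) pp.422–423] -/
theorem weight_mul_norm_adjoint_apply_le_of_kernel
    (T : WL2 𝕜 w V →ₗ[𝕜] WL2 𝕜 w' V) {k : Y → X → ℝ} (hk : ∀ y x, 0 ≤ k y x)
    (hT : ∀ (x : X) (u : V) (y : Y), ‖WL2.equiv 𝕜 w' V (T ((WL2.equiv 𝕜 w V).symm (Pi.single x u))) y‖ ≤ k y x * ‖u‖)
    (f : WL2 𝕜 w' V) {F : ℝ} (hF : 0 ≤ F) (hf : ∀ y, ‖WL2.equiv 𝕜 w' V f y‖ ≤ F) (x : X) :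
    w x * ‖WL2.equiv 𝕜 w V (LinearMap.adjoint T f) x‖ ≤ (∑ y, w' y * k y x) * F := by
  have hwx : 0 < w x := (Fact.out : ∀ x, 0 < w x) x
  have hw' : ∀ y, 0 < w' y := (Fact.out : ∀ y, 0 < w' y)
  set u : V := WL2.equiv 𝕜 w V (LinearMap.adjoint T f) x with hu
  set z : WL2 𝕜 w V := (WL2.equiv 𝕜 w V).symm (Pi.single x u) with hz
  have hS : 0 ≤ ∑ y, w' y * k y x := Finset.sum_nonneg fun y _ => mul_nonneg (hw' y).le (hk y x)
  -- `⟨δ_x·u, T†f⟩ = w(x)·⟨u, u⟩`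
  have h1 : ⟪z, LinearMap.adjoint T f⟫_𝕜 = (w x : 𝕜) * ⟪u, u⟫_𝕜 := by
    rw [WL2.inner_def, Finset.sum_eq_single x]
    · rw [hz, Equiv.apply_symm_apply, Pi.single_eq_same]
    · intro x' _ hx'
      rw [hz, Equiv.apply_symm_apply, Pi.single_eq_of_ne hx', inner_zero_left, mul_zero]
    · intro hx; exact absurd (Finset.mem_univ x) hx
  -- `|⟨T(δ_x·u), f⟩| ≤ (Σ_y w′(y)k(y,x))·‖u‖·F`
  have h2 : ‖⟪T z, f⟫_𝕜‖ ≤ (∑ y, w' y * k y x) * ‖u‖ * F := by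
    rw [WL2.inner_def]
    calc ‖∑ y, (w' y : 𝕜) * ⟪WL2.equiv 𝕜 w' V (T z) y, WL2.equiv 𝕜 w' V f y⟫_𝕜‖
        ≤ ∑ y, ‖(w' y : 𝕜) * ⟪WL2.equiv 𝕜 w' V (T z) y, WL2.equiv 𝕜 w' V f y⟫_𝕜‖ := norm_sum_le _ _
      _ ≤ ∑ y, w' y * (k y x * ‖u‖ * F) := Finset.sum_le_sum fun y _ => by
          rw [norm_mul, RCLike.norm_ofReal, abs_of_pos (hw' y)]
          refine mul_le_mul_of_nonneg_left ((norm_inner_le_norm _ _).trans ?_) (hw' y).le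
          exact mul_le_mul (hT x u y) (hf y) (norm_nonneg _) (mul_nonneg (hk y x) (norm_nonneg u))
      _ = (∑ y, w' y * k y x) * ‖u‖ * F := by rw [Finset.sum_mul, Finset.sum_mul]; exact Finset.sum_congr rfl fun y _ => by ring
  -- `w(x)‖u‖² = re⟨δ_x·u, T†f⟩ ≤ |⟨T(δ_x·u), f⟩|`
  have h3 : w x * ‖u‖ ^ 2 ≤ (∑ y, w' y * k y x) * ‖u‖ * F := by
    have hre : RCLike.re ⟪z, LinearMap.adjoint T f⟫_𝕜 = w x * ‖u‖ ^ 2 := by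
      rw [h1, RCLike.re_ofReal_mul, inner_self_eq_norm_sq]
    calc w x * ‖u‖ ^ 2 = RCLike.re ⟪z, LinearMap.adjoint T f⟫_𝕜 := hre.symm
      _ ≤ ‖⟪z, LinearMap.adjoint T f⟫_𝕜‖ := RCLike.re_le_norm _
      _ = ‖⟪T z, f⟫_𝕜‖ := by rw [LinearMap.adjoint_inner_right]
      _ ≤ (∑ y, w' y * k y x) * ‖u‖ * F := h2
  -- divide by `‖u‖`
  by_cases hu0 : ‖u‖ = 0
  · rw [hu0, mul_zero]; exact mul_nonneg hS hF
  · have hupos : 0 < ‖u‖ := lt_of_le_of_ne (norm_nonneg u) (Ne.symm hu0)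
    have h5 : w x * ‖u‖ * ‖u‖ ≤ (∑ y, w' y * k y x) * F * ‖u‖ := by
      have := h3; rw [pow_two, ← mul_assoc] at this; linarith
    exact le_of_mul_le_mul_right h5 hupos

/-- **Constant weights**: `‖(T†f)(x)‖ ≤ (c₀∕c₁)·(Σ_y k(y,x))·F` for `ℓ²(X; c₁) → ℓ²(Y; c₀)`. [cite: Balaban1985BackgroundPropagators, (3.11) p.392, (3.136)–(3.137) pp.422–423] -/
theorem norm_adjoint_apply_le_of_kernel {c₁ c₀ : ℝ} [Fact (∀ _ : X, 0 < c₁)] [Fact (∀ _ : Y, 0 < c₀)]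
    (T : WL2 𝕜 (fun _ : X => c₁) V →ₗ[𝕜] WL2 𝕜 (fun _ : Y => c₀) V) {k : Y → X → ℝ} (hk : ∀ y x, 0 ≤ k y x)
    (hT : ∀ (x : X) (u : V) (y : Y),
      ‖WL2.equiv 𝕜 (fun _ : Y => c₀) V (T ((WL2.equiv 𝕜 (fun _ : X => c₁) V).symm (Pi.single x u))) y‖ ≤ k y x * ‖u‖)
    (f : WL2 𝕜 (fun _ : Y => c₀) V) {F : ℝ} (hF : 0 ≤ F) (hf : ∀ y, ‖WL2.equiv 𝕜 (fun _ : Y => c₀) V f y‖ ≤ F) (x : X) :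
    ‖WL2.equiv 𝕜 (fun _ : X => c₁) V (LinearMap.adjoint T f) x‖ ≤ c₀ / c₁ * (∑ y, k y x) * F := by
  have hc₁ : (0 : ℝ) < c₁ := (Fact.out : ∀ _ : X, 0 < c₁) x
  have h := weight_mul_norm_adjoint_apply_le_of_kernel T hk hT f hF hf x
  rw [← Finset.mul_sum] at h
  rw [div_mul_eq_mul_div, div_mul_eq_mul_div, le_div_iff₀ hc₁]
  linarith

end Adjoint


/-! ## §2  The fine-bond sum of a block-decaying weight over the tower -/

section Sum

variable {d : ℕ} (L : ℕ) [NeZero L] (m : Fin d → ℕ)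

/-- **`Σ_{fine bonds b} e^{−δ·d(Π(b₋), v)} ≤ d·(L^{n+1})^d·K_δ`** — `d` directions per site, at most `(L^{n+1})^d` sites per big block
(`card_sites_bigBlock_le`), and (2.61) on the unit torus (`torusSum_le`). [cite: Balaban1984PropagatorsII, Lemma 2.1 (2.61) p.234] [cite: Balaban1985Averaging, (2)–(4) pp.17–18] -/
theorem sum_exp_tdist_bigBlock_le (hm : ∀ i, 1 ≤ m i) (n : ℕ) {δ : ℝ} (hδ : 0 < δ) (v : TSite d m) :
    ∑ b : Bond d (towerP L m (n + 1)),
        Real.exp (-(δ * tdist m (blockCoord (L ^ (n + 1)) m (siteCast (towerP_eq_fineP_pow L m (n + 1)) (bpos b))) v)) ≤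
      d * ((L : ℝ) ^ (n + 1)) ^ d * latticeConst d δ := by
  classical
  -- `d` directions per site
  have hdir : ∑ b : Bond d (towerP L m (n + 1)),
        Real.exp (-(δ * tdist m (blockCoord (L ^ (n + 1)) m (siteCast (towerP_eq_fineP_pow L m (n + 1)) (bpos b))) v)) =
      d * ∑ x : TSite d (towerP L m (n + 1)),
        Real.exp (-(δ * tdist m (blockCoord (L ^ (n + 1)) m (siteCast (towerP_eq_fineP_pow L m (n + 1)) x)) v)) := by
    rw [Fintype.sum_prod_type, Finset.mul_sum]
    exact Finset.sum_congr rfl fun x _ => by simp [Finset.sum_const, bpos]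
  -- fibrewise over the blocks
  have hfib : ∑ x : TSite d (towerP L m (n + 1)),
        Real.exp (-(δ * tdist m (blockCoord (L ^ (n + 1)) m (siteCast (towerP_eq_fineP_pow L m (n + 1)) x)) v)) ≤
      ((L : ℝ) ^ (n + 1)) ^ d * ∑ y : TSite d m, Real.exp (-(δ * tdist m y v)) := by
    rw [← Finset.sum_fiberwise_of_maps_to (s := (Finset.univ : Finset (TSite d (towerP L m (n + 1))))) (t := (Finset.univ : Finset (TSite d m)))
      (g := fun x => blockCoord (L ^ (n + 1)) m (siteCast (towerP_eq_fineP_pow L m (n + 1)) x)) (fun _ _ => Finset.mem_univ _),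
      Finset.mul_sum]
    refine Finset.sum_le_sum fun y _ => ?_
    rw [Finset.sum_congr rfl fun x hx => by rw [(Finset.mem_filter.1 hx).2], Finset.sum_const, nsmul_eq_mul]
    have hc : ((Finset.univ.filter fun x : TSite d (towerP L m (n + 1)) =>
        blockCoord (L ^ (n + 1)) m (siteCast (towerP_eq_fineP_pow L m (n + 1)) x) = y).card : ℝ) ≤ ((L : ℝ) ^ (n + 1)) ^ d := by
      exact_mod_cast card_sites_bigBlock_le L m (n + 1) y
    exact mul_le_mul_of_nonneg_right hc (Real.exp_pos _).le
  -- (2.61) on the unit torus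
  have htor : ∑ y : TSite d m, Real.exp (-(δ * tdist m y v)) ≤ latticeConst d δ := by
    rw [Finset.sum_congr rfl fun y _ => by rw [tdist_symm hm y v]]
    exact torusSum_le d hm hδ v
  rw [hdir]
  have hd0 : (0 : ℝ) ≤ d := Nat.cast_nonneg d
  calc (d : ℝ) * ∑ x : TSite d (towerP L m (n + 1)),
          Real.exp (-(δ * tdist m (blockCoord (L ^ (n + 1)) m (siteCast (towerP_eq_fineP_pow L m (n + 1)) x)) v))
      ≤ d * (((L : ℝ) ^ (n + 1)) ^ d * ∑ y : TSite d m, Real.exp (-(δ * tdist m y v))) := mul_le_mul_of_nonneg_left hfib hd0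
    _ ≤ d * (((L : ℝ) ^ (n + 1)) ^ d * latticeConst d δ) :=
        mul_le_mul_of_nonneg_left (mul_le_mul_of_nonneg_left htor (by positivity)) hd0
    _ = d * ((L : ℝ) ^ (n + 1)) ^ d * latticeConst d δ := by ring

end Sum

/-! ## §3  The `(H̃_k†J)`-budget of (3.136) at the tower -/

section Tower

variable {d : ℕ} (hd : 1 ≤ d) (L : ℕ) [NeZero L] (hL : 1 ≤ L) (hL3 : 3 ≤ L)
  {𝔸 : Type*} [NormedRing 𝔸] [NormedAlgebra ℂ 𝔸] [CompleteSpace 𝔸] [NormOneClass 𝔸] [StarRing 𝔸] [NormedStarGroup 𝔸] [StarModule ℂ 𝔸]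
  {W : Type*} [NormedAddCommGroup W] [InnerProductSpace ℂ W] [FiniteDimensional ℂ W] (φ : W ≃ₗ[ℂ] 𝔸)
  {Mφ Mφ' : ℝ} (hMφ : 0 ≤ Mφ) (hMφ' : 0 ≤ Mφ') (hφ : ∀ w, ‖φ w‖ ≤ Mφ * ‖w‖) (hφ' : ∀ X, ‖φ.symm X‖ ≤ Mφ' * ‖X‖) (hstar : ∀ X : 𝔸, ‖star X‖ ≤ ‖X‖)
  {a : ℝ} (ha : 0 < a) {a' : ℝ} (ha' : 0 < a') {ϱ : ℝ} (hϱ0 : 0 ≤ ϱ) (hϱ1 : ϱ < 1)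
  (τ : 𝔸 →ₗ[ℂ] ℂ) {Cτ : ℝ} (hτ : ∀ X, ‖τ X‖ ≤ Cτ * ‖X‖) (hCτ : 0 ≤ Cτ) {Mτ : ℝ} (hτm : ∀ X Y : 𝔸, ‖τ (X * Y)‖ ≤ Mτ * ‖X‖ * ‖Y‖) (hMτ : 0 ≤ Mτ)
  {ρw : ℝ} (hρw : 0 ≤ ρw)
  (hτ₁ : ∀ X : 𝔸, τ (star X) = conj (τ X)) (hτ₂ : ∀ X Y : 𝔸, τ (X * Y) = τ (Y * X)) (hφτ : ∀ X Y : 𝔸, ⟪φ.symm X, φ.symm Y⟫_ℂ = τ (star X * Y))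
  (AQ : ℝ)

set_option maxHeartbeats 400000 in -- margin only, as (K81): the same binder block
include hd hL hL3 hMφ hMφ' hφ hφ' hstar ha ha' hϱ0 hϱ1 hτ hCτ hτm hMτ hρw hτ₁ hτ₂ hφτ in
/-- **THE `(H̃*J)`-BUDGET OF (3.136) AT THE TOWER** — print p. 422: *«From the regularity condition (3.36) and the inequality (3.133) we have the estimate
|(H\*J)(b)| ≦ O(1)Mα₀(Lʲη)⁻³ for b ∈ Λ_j»*, on the cell's model at the top level (`Lᵏη = 1`): `∃ (α₁, j₁, B′)` FIRST; then under (K81)'s binder block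
VERBATIM, for EVERY fine bond field `f` with `‖f(b)‖ ≤ F` and every coarse bond `c`, `‖(H̃_k†f)(c)‖ ≤ B′·F` with `H̃_k† = LinearMap.adjoint
(H1LatticeK hposπ hQ)` the Hilbert adjoint for the weighted scalar products (3.11) (`c₀ = η^d` on the fine bonds, `c₁ = c₀(L^{n+1})^d` on the coarse ones)
and `B′ = d·B·K_δ`, `(B, δ)` = (K81)'s constants of the (3.133) row of `H̃_k`.  Mechanism: §1 at the kernel `k(b,c) = B·e^{−δ d(Π(b₋), c₋)}` ((K81) on the
one-bond source `δ_c·u`), §2 for the column sum, `hw` for the weights' ratio.  At `f := φ⁻¹∘J` (`F = M_φ′j₀`) this is the coefficient budget of (3.136).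
[cite: Balaban1985BackgroundPropagators, (3.136)–(3.137) pp.422–423, (3.133) p.422, (3.126) p.420, (3.36) p.396, (3.11) p.392, Thm 3.11 p.416]
[cite: Balaban1985Variational, (45) p.285, (103) p.293] [cite: Balaban1984PropagatorsII, Lemma 2.1 (2.61) p.234] -/
theorem exists_HJ_budget_tower :
    ∃ α₁ j₁ B : ℝ, 0 < α₁ ∧ 0 < j₁ ∧ 0 ≤ B ∧
      ∀ (n : ℕ) (η : ℝ) (_hηL : η * (L : ℝ) ^ (n + 1) = 1) (c₀ c₁ : ℝ) [Fact (0 < c₀)] [Fact (0 < c₁)]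
        (_hw : c₀ * ((L : ℝ) ^ (n + 1)) ^ d = c₁) (_hρ : |η| ^ d / c₀ ≤ ρw) (m : Fin d → ℕ) [∀ i, NeZero (m i)] (_hm : ∀ i, 1 ≤ m i)
        (U : Bond d (towerP L m (n + 1)) → 𝔸ˣ) (αU : ℕ → ℝ) (_hα0 : ∀ j, 0 ≤ αU j) (hα1 : ∀ j, αU j ≤ 1 / 64)
        (hαL : ∀ j, 50 * (d + 1) * αU j * (L : ℝ) ^ d ≤ 1 / 2)
        (hU1 : ∀ (j : ℕ) (x : B7Prop1Explicit.Site d) (k : Fin d), perCfg (towerP L m (j + 1)) (UlevOf L m (n + 1) U j) x k ∈ U1 𝔸)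
        (hreg : ∀ (j : ℕ) (y : TSite d (towerP L m j)) (k : Fin d) (ρ' : Fin d → Fin L),
          ‖((Wcx L (perCfg (towerP L m (j + 1)) (UlevOf L m (n + 1) U j)) (cornerSite L y) k (boxVec L ρ') : 𝔸ˣ) : 𝔸) - 1‖ ≤ αU j)
        (εU : ℕ → ℝ) (_hεU : ∀ j, 0 ≤ εU j) (_hUε : ∀ (j : ℕ) (b : Bond d (towerP L m (j + 1))), ‖(UlevOf L m (n + 1) U j b : 𝔸) - 1‖ ≤ εU j)
        (_hLb : ∀ (j : ℕ) (b : Bond d (towerP L m (j + 1))), UlevOf L m (n + 1) U j b ∈ U1 𝔸)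
        (α : ℝ) (_hα : 0 ≤ α) (_hαle : α ≤ α₁)
        (hUst : ∀ b, star (U b : 𝔸) = (((U b)⁻¹ : 𝔸ˣ) : 𝔸)) (_hUb : ∀ b, U b ∈ U1 𝔸) (_hUη : ∀ b, ‖(U b : 𝔸) - 1‖ ≤ α * η)
        (_hpl : ∀ p : B9SectCLatticeCarrier.Plaq d (towerP L m (n + 1)), ‖(plaqHolU U p : 𝔸) - 1‖ ≤ α * η ^ 2)
        (_hUgrad : ∀ (x : TSite d (towerP L m (n + 1))) (μ : Fin d), ‖(U (x, μ) : 𝔸) - U (unshift μ x, μ)‖ ≤ α * η ^ 2)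
        (_hRlev : ∀ (j : ℕ) (b : Bond d (towerP L m (j + 1))) (w : W), ‖adTransportW φ (UlevOf L m (n + 1) U j) b w‖ ≤ ‖w‖)
        (_hεg : ∀ j < n + 1, εU j ≤ α * ϱ ^ j) (_hAQ : ∑ j ∈ Finset.range (n + 1), αU j ≤ AQ)
        (hpos' : ∀ x : SiteL2K ℂ d (towerP L m (n + 1)) c₀ W, x ≠ 0 → 0 < RCLike.re ⟪x, laplacePrimeAk L m n φ η U a' (c₁ := c₁) x⟫_ℂ)
        (hpos : ∀ x : BondL2K ℂ d (towerP L m (n + 1)) c₀ W, x ≠ 0 →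
          0 < RCLike.re ⟪x, laplaceAk L m n φ η U hL αU hα1 hU1 hreg τ (c₀ := c₀) (c₁ := c₁) a x⟫_ℂ)
        (_hc₀η : c₀ = η ^ d) (j₀ : ℝ) (_hJ : ∀ μ y, ‖B9Eq39Adjoint.J (fun μ => B9Eq33CovDerivVector.shiftEquiv μ) (fun μ y => U (y, μ)) η μ y‖ ≤ j₀) (_hj : j₀ ≤ j₁)
        (hposπ : ∀ x : BondL2K ℂ d (towerP L m (n + 1)) c₀ W, x ≠ 0 →
          0 < RCLike.re ⟪x, laplaceAkPi L m n φ τ η U a' hpos' hL αU hα1 hU1 hreg (c₁ := c₁) a x⟫_ℂ)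
        (hQ : Function.Surjective (QkW L m n φ U hL αU hα1 hU1 hreg (c₀ := c₀) (c₁ := c₁)))
        (f : BondL2K ℂ d (towerP L m (n + 1)) c₀ W) (F : ℝ)
        (_hfF : ∀ b, ‖WL2.equiv ℂ (fun _ : Bond d (towerP L m (n + 1)) => c₀) W f b‖ ≤ F) (c : Bond d m),
        ‖WL2.equiv ℂ (fun _ : Bond d m => c₁) W (LinearMap.adjoint (H1LatticeK hposπ hQ) f) c‖ ≤ B * F := by
  classical
  obtain ⟨α₁, j₁, B, δ, hα₁, hj₁, hB, hδ, HK⟩ :=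
    exists_local_letter_H1LatticeKPi hd L hL hL3 φ hMφ hMφ' hφ hφ' hstar ha ha' hϱ0 hϱ1 τ hτ hCτ hτm hMτ hρw hτ₁ hτ₂ hφτ AQ
  have hK0 : 0 ≤ latticeConst d δ := latticeConst_nonneg d hδ.le
  refine ⟨α₁, j₁, d * B * latticeConst d δ, hα₁, hj₁, by positivity, ?_⟩
  intro n η hηL c₀ c₁ _ _ hw hρ m _ hm U αU hα0 hα1 hαL hU1 hreg εU hεU hUε hLb α hα hαle hUst hUb hUη hpl hUgrad hRlev hεg hAQ hpos' hpos hc₀η j₀ hJ hj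
    hposπ hQ f F hfF c
  have hc₀ : (0 : ℝ) < c₀ := Fact.out
  have hc₁ : (0 : ℝ) < c₁ := Fact.out
  have hF : 0 ≤ F := (norm_nonneg _).trans (hfF ((fun _ => 0), c.2))
  -- (K81) on the one-bond source `δ_c·u`: the kernel `k(b, c) = B·e^{−δ d(Π(b₋), c₋)}`
  have hT : ∀ (c' : Bond d m) (u : W) (b : Bond d (towerP L m (n + 1))),
      ‖WL2.equiv ℂ (fun _ : Bond d (towerP L m (n + 1)) => c₀) W (H1LatticeK hposπ hQ
          ((WL2.equiv ℂ (fun _ : Bond d m => c₁) W).symm (Pi.single c' u))) b‖ ≤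
        (B * Real.exp (-(δ * tdist m (blockCoord (L ^ (n + 1)) m (siteCast (towerP_eq_fineP_pow L m (n + 1)) (bpos b))) (bpos c')))) * ‖u‖ := by
    intro c' u b
    refine HK n η hηL c₀ c₁ hw hρ m hm U αU hα0 hα1 hαL hU1 hreg εU hεU hUε hLb α hα hαle hUst hUb hUη hpl hUgrad hRlev hεg hAQ hpos' hpos hc₀η j₀ hJ hj
      hposπ hQ (bpos c') _ ‖u‖ (fun b' hb' => ?_) (fun b' => ?_) b
    · rw [Equiv.apply_symm_apply, Pi.single_eq_of_ne]
      rintro rfl; exact hb' rfl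
    · rw [Equiv.apply_symm_apply]
      by_cases hb : b' = c'
      · rw [hb, Pi.single_eq_same]
      · rw [Pi.single_eq_of_ne hb, norm_zero]; exact norm_nonneg u
  -- §1: the adjoint's row; §2: the column sum; the weights' ratio `c₀(L^{n+1})^d∕c₁ = 1`
  have h1 := norm_adjoint_apply_le_of_kernel (H1LatticeK hposπ hQ) (fun b c' => by positivity) hT f hF hfF c
  have hS := sum_exp_tdist_bigBlock_le L m hm n hδ (bpos c)
  have hratio : c₀ / c₁ * ((L : ℝ) ^ (n + 1)) ^ d = 1 := by
    rw [div_mul_eq_mul_div, hw, div_self hc₁.ne']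
  calc ‖WL2.equiv ℂ (fun _ : Bond d m => c₁) W (LinearMap.adjoint (H1LatticeK hposπ hQ) f) c‖
      ≤ c₀ / c₁ * (∑ b : Bond d (towerP L m (n + 1)),
          B * Real.exp (-(δ * tdist m (blockCoord (L ^ (n + 1)) m (siteCast (towerP_eq_fineP_pow L m (n + 1)) (bpos b))) (bpos c)))) * F := h1
    _ = c₀ / c₁ * (B * ∑ b : Bond d (towerP L m (n + 1)),
          Real.exp (-(δ * tdist m (blockCoord (L ^ (n + 1)) m (siteCast (towerP_eq_fineP_pow L m (n + 1)) (bpos b))) (bpos c)))) * F := by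
        rw [← Finset.mul_sum]
    _ ≤ c₀ / c₁ * (B * (d * ((L : ℝ) ^ (n + 1)) ^ d * latticeConst d δ)) * F :=
        mul_le_mul_of_nonneg_right (mul_le_mul_of_nonneg_left (mul_le_mul_of_nonneg_left hS hB) (div_nonneg hc₀.le hc₁.le)) hF
    _ = (c₀ / c₁ * ((L : ℝ) ^ (n + 1)) ^ d) * (d * B * latticeConst d δ) * F := by ring
    _ = d * B * latticeConst d δ * F := by rw [hratio, one_mul]

end Tower

end Literature.MathematicalPhysics.QuantumFieldTheory.Balaban1983to89.Beta.RemainderHJBudgetTower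

end
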